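import Summits.PneNP.PneNP.Theses.DelsarteLasserre
import Literature.Computability.Complexity.KarpCliqueNP
import Literature.Computability.Complexity.CodeFPArith
import Literature.Computability.Complexity.CodeFPStrings
import Literature.Computability.Complexity.CodeFPLists

/-!
# Route DelsarteLasserre — the typed certificate test for `CodeSizeLangInNEXP` (helper for stmt-PneNP-2130)

On `⟨x, y⟩` — the instance `x = ⟨1ⁿ, ⟨1ᵈ, u⟩⟩` and a certificate `y` read as `K = bitsToNat u` consecutive blocks of `n`
bits — ONE typed `CodeFP` program tests: `x` is well paired twice with all-ones headers; `K ≤ |y|` and `n·K ≤ |y|`; and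
for all `i < j < K` the blocks `(y ⇂ i n) ↾ n` are distinct with at least `d` differing positions among the first `n`.
The program is packaged with its SPECIFICATION (`delsarteLasserre_exists_codeTest`).
-/

set_option linter.dupNamespace false -- `Summit.PneNP.PneNP.…`: summit = sub-problem name (D-0017 single-conjunct layout)

namespace Summit.PneNP.PneNP.Theorems

open _root_.Computability Polynomial
open Literature.Computability.Complexity Literature.Computability.Complexity.CodeFP
  Literature.Computability.Complexity.Brick

/-- **The typed certificate test and its specification.** [cite: AroraBarak2009, §2.6.2] [folklore] -/
theorem delsarteLasserre_exists_codeTest :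
    ∃ τ : List Bool → Bool, CodeFP strE bitE τ ∧ ∀ x y : List Bool, τ (boolPair x y) = true ↔
      (boolPair (fstF x) (sndF x) = x ∧ boolPair (fstF (sndF x)) (sndF (sndF x)) = sndF x ∧
        fstF x = List.replicate (fstF x).length true ∧ fstF (sndF x) = List.replicate (fstF (sndF x)).length true ∧
        bitsToNat (sndF (sndF x)) ≤ y.length ∧ (fstF x).length * bitsToNat (sndF (sndF x)) ≤ y.length ∧
        ∀ i, i < bitsToNat (sndF (sndF x)) → ∀ j, j < bitsToNat (sndF (sndF x)) → i < j →
          (y.drop (i * (fstF x).length)).take (fstF x).length ≠ (y.drop (j * (fstF x).length)).take (fstF x).length ∧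
          (fstF (sndF x)).length ≤ ((List.range (fstF x).length).map fun l =>
            if ((y.drop (i * (fstF x).length)).take (fstF x).length).getD l false =
                ((y.drop (j * (fstF x).length)).take (fstF x).length).getD l false then 0 else 1).sum) := by
  -- string-level pieces
  have hfst : CodeFP strE strE fun w : List Bool => fstF w := CodeFP.of_fn fstF fstF_mem_FP fun _ => rfl
  have hsnd : CodeFP strE strE fun w : List Bool => sndF w := CodeFP.of_fn sndF sndF_mem_FP fun _ => rfl
  have hwp0 : CodeFP strE bitE fun w : List Bool => decide (boolPair (fstF w) (sndF w) = w) :=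
    CodeFP.of_fn CliqueNP.wpF CliqueNP.wpF_mem_FP fun w => by rw [CliqueNP.wpF_apply]; rfl
  have hones0 : CodeFP strE strE fun w : List Bool => List.replicate w.length true :=
    CodeFP.of_fn onesFn onesFn_mem_FP fun w => (unE_eq_ones w.length).trans rfl
  have hall1 : CodeFP strE bitE fun w : List Bool => decide (w = List.replicate w.length true) :=
    ((CodeFP.eq (α := List Bool) (eα := strE) Function.injective_id).comp ((CodeFP.id strE).pair hones0) :)
  -- the block reader on `((y, n), i)`: `(y ⇂ min (i n) |y|) ↾ n`
  have hblk : CodeFP (pairE (pairE strE unE) natE) strE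
      fun q : (List Bool × ℕ) × ℕ => (q.1.1.drop (q.2 * q.1.2)).take q.1.2 := by
    have qy : CodeFP (pairE (pairE strE unE) natE) strE fun q : (List Bool × ℕ) × ℕ => q.1.1 := (CodeFP.fst _ _).fst'
    have qn : CodeFP (pairE (pairE strE unE) natE) unE fun q : (List Bool × ℕ) × ℕ => q.1.2 := (CodeFP.fst _ _).snd'
    have qi : CodeFP (pairE (pairE strE unE) natE) natE fun q : (List Bool × ℕ) × ℕ => q.2 := CodeFP.snd _ _
    have qm : CodeFP (pairE (pairE strE unE) natE) natE fun q : (List Bool × ℕ) × ℕ => q.2 * q.1.2 :=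
      (natMul.comp (qi.pair (natOfUn.comp qn)) :)
    have qmu : CodeFP (pairE (pairE strE unE) natE) unE fun q : (List Bool × ℕ) × ℕ => min (q.2 * q.1.2) q.1.1.length :=
      (unOfNatMin.comp ((strLength.comp qy).pair qm) :)
    have qdrop : CodeFP (pairE (pairE strE unE) natE) strE
        fun q : (List Bool × ℕ) × ℕ => q.1.1.drop (min (q.2 * q.1.2) q.1.1.length) := (strDrop.comp (qmu.pair qy) :)
    refine ((strTake.comp (qn.pair qdrop) :)).congr fun q => ?_
    show (q.1.1.drop (min (q.2 * q.1.2) q.1.1.length)).take q.1.2 = _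
    rcases le_total (q.2 * q.1.2) q.1.1.length with h | h
    · rw [min_eq_left h]
    · rw [min_eq_right h, List.drop_length, List.drop_eq_nil_of_le h]
  -- the differing-position count on `((b₁, b₂), n)`-data, read as context `(b₁, b₂)` over `range n`
  have hind : CodeFP (pairE (pairE strE strE) natE) natE
      fun e : (List Bool × List Bool) × ℕ => if decide (e.1.1.getD e.2 false = e.1.2.getD e.2 false) then 0 else 1 := by
    have e1 : CodeFP (pairE (pairE strE strE) natE) bitE fun e : (List Bool × List Bool) × ℕ => e.1.1.getD e.2 false :=
      (strGetDNat.comp ((CodeFP.fst _ _).fst'.pair (CodeFP.snd _ _)) :)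
    have e2 : CodeFP (pairE (pairE strE strE) natE) bitE fun e : (List Bool × List Bool) × ℕ => e.1.2.getD e.2 false :=
      (strGetDNat.comp ((CodeFP.fst _ _).snd'.pair (CodeFP.snd _ _)) :)
    exact ((CodeFP.eq bitE_injective).comp (e1.pair e2) :).ite (CodeFP.const _ 0) (CodeFP.const _ 1)
  have hcount : CodeFP (pairE (pairE strE strE) (rawE natE)) natE
      fun e : (List Bool × List Bool) × List ℕ => (e.2.map fun l =>
        if decide (e.1.1.getD l false = e.1.2.getD l false) then 0 else 1).sum :=
    (natSum.comp (CodeFP.map hind) :)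
  -- the pair test on `r = ((σ, i), j)`, `σ = (((y, n), d), K)`
  have ry : CodeFP (pairE (pairE (pairE (pairE (pairE strE unE) unE) natE) natE) natE) strE
      fun r : ((((List Bool × ℕ) × ℕ) × ℕ) × ℕ) × ℕ => r.1.1.1.1.1 := (CodeFP.fst _ _).fst'.fst'.fst'.fst'
  have rn : CodeFP (pairE (pairE (pairE (pairE (pairE strE unE) unE) natE) natE) natE) unE
      fun r : ((((List Bool × ℕ) × ℕ) × ℕ) × ℕ) × ℕ => r.1.1.1.1.2 := (CodeFP.fst _ _).fst'.fst'.fst'.snd'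
  have rd : CodeFP (pairE (pairE (pairE (pairE (pairE strE unE) unE) natE) natE) natE) unE
      fun r : ((((List Bool × ℕ) × ℕ) × ℕ) × ℕ) × ℕ => r.1.1.1.2 := (CodeFP.fst _ _).fst'.fst'.snd'
  have ri : CodeFP (pairE (pairE (pairE (pairE (pairE strE unE) unE) natE) natE) natE) natE
      fun r : ((((List Bool × ℕ) × ℕ) × ℕ) × ℕ) × ℕ => r.1.2 := (CodeFP.fst _ _).snd'
  have rj : CodeFP (pairE (pairE (pairE (pairE (pairE strE unE) unE) natE) natE) natE) natE
      fun r : ((((List Bool × ℕ) × ℕ) × ℕ) × ℕ) × ℕ => r.2 := CodeFP.snd _ _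
  have rbi : CodeFP (pairE (pairE (pairE (pairE (pairE strE unE) unE) natE) natE) natE) strE
      fun r : ((((List Bool × ℕ) × ℕ) × ℕ) × ℕ) × ℕ =>
        (r.1.1.1.1.1.drop (r.1.2 * r.1.1.1.1.2)).take r.1.1.1.1.2 :=
    (hblk.comp ((ry.pair rn).pair ri) :)
  have rbj : CodeFP (pairE (pairE (pairE (pairE (pairE strE unE) unE) natE) natE) natE) strE
      fun r : ((((List Bool × ℕ) × ℕ) × ℕ) × ℕ) × ℕ =>
        (r.1.1.1.1.1.drop (r.2 * r.1.1.1.1.2)).take r.1.1.1.1.2 :=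
    (hblk.comp ((ry.pair rn).pair rj) :)
  have rneq : CodeFP (pairE (pairE (pairE (pairE (pairE strE unE) unE) natE) natE) natE) bitE
      fun r : ((((List Bool × ℕ) × ℕ) × ℕ) × ℕ) × ℕ =>
        !decide ((r.1.1.1.1.1.drop (r.1.2 * r.1.1.1.1.2)).take r.1.1.1.1.2 =
          (r.1.1.1.1.1.drop (r.2 * r.1.1.1.1.2)).take r.1.1.1.1.2) :=
    ((CodeFP.eq (α := List Bool) (eα := strE) Function.injective_id).comp (rbi.pair rbj) :).not
  have rdist : CodeFP (pairE (pairE (pairE (pairE (pairE strE unE) unE) natE) natE) natE) natE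
      fun r : ((((List Bool × ℕ) × ℕ) × ℕ) × ℕ) × ℕ => ((List.range r.1.1.1.1.2).map fun l =>
        if decide (((r.1.1.1.1.1.drop (r.1.2 * r.1.1.1.1.2)).take r.1.1.1.1.2).getD l false =
            ((r.1.1.1.1.1.drop (r.2 * r.1.1.1.1.2)).take r.1.1.1.1.2).getD l false)
          then 0 else 1).sum :=
    (hcount.comp ((rbi.pair rbj).pair (urange.comp rn)) :)
  have rle : CodeFP (pairE (pairE (pairE (pairE (pairE strE unE) unE) natE) natE) natE) bitE
      fun r : ((((List Bool × ℕ) × ℕ) × ℕ) × ℕ) × ℕ => decide (r.1.1.1.2 ≤ ((List.range r.1.1.1.1.2).map fun l =>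
        if decide (((r.1.1.1.1.1.drop (r.1.2 * r.1.1.1.1.2)).take r.1.1.1.1.2).getD l false =
            ((r.1.1.1.1.1.drop (r.2 * r.1.1.1.1.2)).take r.1.1.1.1.2).getD l false)
          then 0 else 1).sum) :=
    (unLeNat.comp (rd.pair rdist) :)
  have rlt : CodeFP (pairE (pairE (pairE (pairE (pairE strE unE) unE) natE) natE) natE) bitE
      fun r : ((((List Bool × ℕ) × ℕ) × ℕ) × ℕ) × ℕ => decide (r.1.2 < r.2) := (natLt.comp (ri.pair rj) :)
  have rtest := (rlt.not).or (rneq.and rle)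
  -- inner `all` over `j ∈ range (min K |y|)` with context `(σ, i)`
  have sK : CodeFP (pairE (pairE (pairE (pairE strE unE) unE) natE) natE) natE
      fun s : (((List Bool × ℕ) × ℕ) × ℕ) × ℕ => s.1.2 := (CodeFP.fst _ _).snd'
  have sylen : CodeFP (pairE (pairE (pairE (pairE strE unE) unE) natE) natE) unE
      fun s : (((List Bool × ℕ) × ℕ) × ℕ) × ℕ => s.1.1.1.1.length := (strLength.comp (CodeFP.fst _ _).fst'.fst'.fst' :)
  have sR : CodeFP (pairE (pairE (pairE (pairE strE unE) unE) natE) natE) (rawE natE)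
      fun s : (((List Bool × ℕ) × ℕ) × ℕ) × ℕ => List.range (min s.1.2 s.1.1.1.1.length) := (rangeOf.comp (sylen.pair sK) :)
  have sall := ((CodeFP.all rtest).comp ((CodeFP.id _).pair sR) :)
  -- outer `all` over `i ∈ range (min K |y|)` with context `σ`
  have tK : CodeFP (pairE (pairE (pairE strE unE) unE) natE) natE fun t : ((List Bool × ℕ) × ℕ) × ℕ => t.2 := CodeFP.snd _ _
  have tylen : CodeFP (pairE (pairE (pairE strE unE) unE) natE) unE fun t : ((List Bool × ℕ) × ℕ) × ℕ => t.1.1.1.length :=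
    (strLength.comp (CodeFP.fst _ _).fst'.fst' :)
  have tR : CodeFP (pairE (pairE (pairE strE unE) unE) natE) (rawE natE)
      fun t : ((List Bool × ℕ) × ℕ) × ℕ => List.range (min t.2 t.1.1.1.length) := (rangeOf.comp (tylen.pair tK) :)
  have tall := ((CodeFP.all sall).comp ((CodeFP.id _).pair tR) :)
  -- the data on `z`
  have zx : CodeFP strE strE fun z : List Bool => fstF z := hfst
  have zy : CodeFP strE strE fun z : List Bool => sndF z := hsnd
  have za : CodeFP strE strE fun z : List Bool => fstF (fstF z) := (hfst.comp zx :)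
  have zrest : CodeFP strE strE fun z : List Bool => sndF (fstF z) := (hsnd.comp zx :)
  have zb : CodeFP strE strE fun z : List Bool => fstF (sndF (fstF z)) := (hfst.comp zrest :)
  have zu : CodeFP strE strE fun z : List Bool => sndF (sndF (fstF z)) := (hsnd.comp zrest :)
  have zn : CodeFP strE unE fun z : List Bool => (fstF (fstF z)).length := (strLength.comp za :)
  have zd : CodeFP strE unE fun z : List Bool => (fstF (sndF (fstF z))).length := (strLength.comp zb :)
  have zK : CodeFP strE natE fun z : List Bool => bitsToNat (sndF (sndF (fstF z))) := (strVal.comp zu :)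
  have zylen : CodeFP strE unE fun z : List Bool => (sndF z).length := (strLength.comp zy :)
  have c1 : CodeFP strE bitE fun z : List Bool => decide (boolPair (fstF (fstF z)) (sndF (fstF z)) = fstF z) := (hwp0.comp zx :)
  have c2 : CodeFP strE bitE fun z : List Bool => decide (boolPair (fstF (sndF (fstF z))) (sndF (sndF (fstF z))) = sndF (fstF z)) :=
    (hwp0.comp zrest :)
  have c3 : CodeFP strE bitE fun z : List Bool => decide (fstF (fstF z) = List.replicate (fstF (fstF z)).length true) :=
    (hall1.comp za :)
  have c4 : CodeFP strE bitE fun z : List Bool =>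
      decide (fstF (sndF (fstF z)) = List.replicate (fstF (sndF (fstF z))).length true) := (hall1.comp zb :)
  have c5 : CodeFP strE bitE fun z : List Bool => decide (bitsToNat (sndF (sndF (fstF z))) ≤ (sndF z).length) :=
    (natLeUn.comp (zK.pair zylen) :)
  have c6 : CodeFP strE bitE fun z : List Bool =>
      decide ((fstF (fstF z)).length * bitsToNat (sndF (sndF (fstF z))) ≤ (sndF z).length) :=
    (natLeUn.comp ((natMul.comp ((natOfUn.comp zn).pair zK)).pair zylen) :)
  have c7 := (tall.comp ((((zy.pair zn).pair zd).pair zK)) :)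
  refine ⟨_, ((c1.and c2).and (c3.and c4)).and ((c5.and c6).and c7), fun x y => ?_⟩
  simp only [fstF_boolPair, sndF_boolPair, Bool.and_eq_true, decide_eq_true_eq, List.all_eq_true,
    Bool.or_eq_true, Bool.not_eq_true', decide_eq_false_iff_not, not_lt, List.mem_range, id]
  constructor
  · rintro ⟨⟨⟨h1, h2⟩, h3, h4⟩, ⟨h5, h6⟩, h7⟩
    refine ⟨h1, h2, h3, h4, h5, h6, fun i hi j hj hij => ?_⟩
    have h := h7 i (by rw [min_eq_left h5]; exact hi) j (by rw [min_eq_left h5]; exact hj)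
    rcases h with h | ⟨hne, hle⟩
    · exact absurd hij (not_lt.2 h)
    · exact ⟨hne, hle⟩
  · rintro ⟨h1, h2, h3, h4, h5, h6, h7⟩
    refine ⟨⟨⟨h1, h2⟩, h3, h4⟩, ⟨h5, h6⟩, fun i hi j hj => ?_⟩
    rw [min_eq_left h5] at hi hj
    rcases le_or_gt j i with hji | hij
    · exact Or.inl hji
    · exact Or.inr (h7 i hi j hj hij)

end Summit.PneNP.PneNP.Theorems
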